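import Mathlib.Tactic.Ring
import Mathlib.Tactic.Linarith
import Mathlib.Tactic.Positivity
import Mathlib.Data.Real.Basic
import HarnessLib

/-!
# Conjecture N (hodge-weil ladder, GAPS G51b), THE VERTEX FORM of the charge-zero class-test quantity `G₀`; CONJECTURE K proved

Prover 2, generation 12 (note `run/shared/lean/b2b/hodge-weil/b2b-hweil-pv2-g12/VERTEX-FORM-G12.md`). Companion of
`WeilClassTestClusterLemmas.lean` / `WeilClassTestEscapeDirections.lean` (generation 11). Setting (`CONJECTURE-N.md` §1, real charges):
a signed configuration of roots `k` with signs `ε_k = +1` (E) / `−1` (F), positions `y_k`, charges `u_k`; signed mass `m = Σε`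
(`m = 2` for the class test in format `(f+2, f)`, `m = 1` for the five-root cluster of generation 11); centred coordinates
`Y_k = y_k − yb`, `Z_k = u_k − ub` with the signed means `yb = (Σεy)/m`, `ub = (Σεu)/m`; `S_y = ΣεY²`, `S_ζ = ΣεZ²`, `S_{yζ} = ΣεYZ`,
`S_{y²ζ²} = ΣεY²Z²`, `S_{ζ⁴} = ΣεZ⁴`; `Q₂ = ½S_yS_ζ + S_{yζ}² − 3S_{y²ζ²}`, `Q₄ = 3S_{ζ⁴} − (3/2)S_ζ²`, `G₀ = Q₂ + Q₄`.

THE VERTEX FORM (new). For ANY reference point `V = (yV, uV)` put `p_k = ε_k((y_k + u_k) − (yV + uV))`, `q_k = ε_k((y_k − u_k) − (yV − uV))`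
(light-cone 'corner coordinates'). Then, as a polynomial identity,
  `G₀ = 2 Σ_{k,l} H_kl q_k p_l`, `H_kl = ½Z_kZ_l + (3/2m)(Z_k² + Z_l²) + (1/4m + 3/2m²)·D` (`k ≠ l`), `D := −S_ζ`,
  `H_kk = 2Z_k² + (3/2)D` (E) / `5Z_k² + 2D` (F) for `m = 1`;  `H_kk = ½Z_k² + ¼D` (E) / `(7/2)Z_k² + ¾D` (F) for `m = 2`
(the vector `ε` is in the kernel of `H`, which is why `V` is arbitrary). A configuration is DOMINANT AND PAIRWISE AMPLE
(`y_e − y_f ≥ |u_e − u_f|` for all `e ∈ E`, `f ∈ F`) iff some `V` has all `p_k, q_k ≥ 0` (E-roots in the future light cone of `V`, F-roots in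
its past cone; e.g. `V =` the componentwise light-cone maximum of the F-roots). Since `(3/2m)(a² + b²) + ½ab ≥ 0`, every `H_kl ≥ 0` as soon as
`D ≥ 0`, i.e. `S_ζ ≤ 0`. CONSEQUENCES: (1) CONJECTURE K of generation 11 (`CROSS-MAX-G11.md` A1.3: every centred dominant ample (3,2)
cluster with `S_ζ ≤ 0` has `G₀(C) ≥ 0`) — `cluster_G0_nonneg` (vertex form) and `cluster_G0_nonneg_frame` (literally in the frame
coordinates of `WeilClassTestClusterLemmas`); (2) in format (4,2) — mass 2, the class test itself — every dominant pairwise-ample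
configuration with `S_u ≤ 0` has `G₀ ≥ 0` WITHOUT ANY PURITY HYPOTHESIS (`format42_G0_nonneg_of_Su_nonpos`); Conjecture N in format
(4,2) is thereby reduced to the charge region `S_u > 0`. Pure algebra (`ring`) plus products of non-negative reals; nothing here is a
rung, a door edge or a cited fact; no statement of Markman's papers is used. New cell result ⇒ Summits/.
-/

set_option linter.dupNamespace false

namespace Summit.HodgeConjecture.HodgeConjecture.WeilClassTestVertexForm

/-- VERTEX FORM, mass 1 (the (3,2) cluster: E-roots `1,2,3`, F-roots `4,5`): `G₀ = 2Σ_{k,l} H_kl q_k p_l` for an arbitrary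
reference point `(yV, uV)` — a polynomial identity (`ring`). -/
theorem cluster_G0_vertex_identity (y₁ y₂ y₃ y₄ y₅ u₁ u₂ u₃ u₄ u₅ yV uV : ℝ) :
    let yb : ℝ := y₁ + y₂ + y₃ - y₄ - y₅
    let ub : ℝ := u₁ + u₂ + u₃ - u₄ - u₅
    let Y₁ : ℝ := y₁ - yb
    let Y₂ : ℝ := y₂ - yb
    let Y₃ : ℝ := y₃ - yb
    let Y₄ : ℝ := y₄ - yb
    let Y₅ : ℝ := y₅ - yb
    let Z₁ : ℝ := u₁ - ub
    let Z₂ : ℝ := u₂ - ub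
    let Z₃ : ℝ := u₃ - ub
    let Z₄ : ℝ := u₄ - ub
    let Z₅ : ℝ := u₅ - ub
    let Sy : ℝ := Y₁ ^ 2 + Y₂ ^ 2 + Y₃ ^ 2 - (Y₄ ^ 2 + Y₅ ^ 2)
    let Sz : ℝ := Z₁ ^ 2 + Z₂ ^ 2 + Z₃ ^ 2 - (Z₄ ^ 2 + Z₅ ^ 2)
    let Syz : ℝ := Y₁ * Z₁ + Y₂ * Z₂ + Y₃ * Z₃ - (Y₄ * Z₄ + Y₅ * Z₅)
    let Sy2z2 : ℝ := Y₁ ^ 2 * Z₁ ^ 2 + Y₂ ^ 2 * Z₂ ^ 2 + Y₃ ^ 2 * Z₃ ^ 2 - (Y₄ ^ 2 * Z₄ ^ 2 + Y₅ ^ 2 * Z₅ ^ 2)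
    let Sz4 : ℝ := Z₁ ^ 4 + Z₂ ^ 4 + Z₃ ^ 4 - (Z₄ ^ 4 + Z₅ ^ 4)
    let D : ℝ := -Sz
    let p₁ : ℝ := (y₁ + u₁) - (yV + uV)
    let q₁ : ℝ := (y₁ - u₁) - (yV - uV)
    let p₂ : ℝ := (y₂ + u₂) - (yV + uV)
    let q₂ : ℝ := (y₂ - u₂) - (yV - uV)
    let p₃ : ℝ := (y₃ + u₃) - (yV + uV)
    let q₃ : ℝ := (y₃ - u₃) - (yV - uV)
    let p₄ : ℝ := (yV + uV) - (y₄ + u₄)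
    let q₄ : ℝ := (yV - uV) - (y₄ - u₄)
    let p₅ : ℝ := (yV + uV) - (y₅ + u₅)
    let q₅ : ℝ := (yV - uV) - (y₅ - u₅)
    1 / 2 * Sy * Sz + Syz ^ 2 - 3 * Sy2z2 + (3 * Sz4 - 3 / 2 * Sz ^ 2)
      = 2 * ((2 * Z₁ ^ 2 + 3/2 * D) * (q₁ * p₁)
        + (1/2 * Z₁ * Z₂ + 3/2 * (Z₁ ^ 2 + Z₂ ^ 2) + 7/4 * D) * (q₁ * p₂ + q₂ * p₁)
        + (1/2 * Z₁ * Z₃ + 3/2 * (Z₁ ^ 2 + Z₃ ^ 2) + 7/4 * D) * (q₁ * p₃ + q₃ * p₁)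
        + (1/2 * Z₁ * Z₄ + 3/2 * (Z₁ ^ 2 + Z₄ ^ 2) + 7/4 * D) * (q₁ * p₄ + q₄ * p₁)
        + (1/2 * Z₁ * Z₅ + 3/2 * (Z₁ ^ 2 + Z₅ ^ 2) + 7/4 * D) * (q₁ * p₅ + q₅ * p₁)
        + (2 * Z₂ ^ 2 + 3/2 * D) * (q₂ * p₂)
        + (1/2 * Z₂ * Z₃ + 3/2 * (Z₂ ^ 2 + Z₃ ^ 2) + 7/4 * D) * (q₂ * p₃ + q₃ * p₂)
        + (1/2 * Z₂ * Z₄ + 3/2 * (Z₂ ^ 2 + Z₄ ^ 2) + 7/4 * D) * (q₂ * p₄ + q₄ * p₂)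
        + (1/2 * Z₂ * Z₅ + 3/2 * (Z₂ ^ 2 + Z₅ ^ 2) + 7/4 * D) * (q₂ * p₅ + q₅ * p₂)
        + (2 * Z₃ ^ 2 + 3/2 * D) * (q₃ * p₃)
        + (1/2 * Z₃ * Z₄ + 3/2 * (Z₃ ^ 2 + Z₄ ^ 2) + 7/4 * D) * (q₃ * p₄ + q₄ * p₃)
        + (1/2 * Z₃ * Z₅ + 3/2 * (Z₃ ^ 2 + Z₅ ^ 2) + 7/4 * D) * (q₃ * p₅ + q₅ * p₃)
        + (5 * Z₄ ^ 2 + 2 * D) * (q₄ * p₄)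
        + (1/2 * Z₄ * Z₅ + 3/2 * (Z₄ ^ 2 + Z₅ ^ 2) + 7/4 * D) * (q₄ * p₅ + q₅ * p₄)
        + (5 * Z₅ ^ 2 + 2 * D) * (q₅ * p₅)) := by
  intro yb ub Y₁ Y₂ Y₃ Y₄ Y₅ Z₁ Z₂ Z₃ Z₄ Z₅ Sy Sz Syz Sy2z2 Sz4 D p₁ q₁ p₂ q₂ p₃ q₃ p₄ q₄ p₅ q₅
  simp only [q₅, p₅, q₄, p₄, q₃, p₃, q₂, p₂, q₁, p₁, D, Sz4, Sy2z2, Syz, Sz, Sy, Z₅, Z₄, Z₃, Z₂, Z₁, Y₅, Y₄, Y₃, Y₂, Y₁, ub, yb]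
  ring

/-- Every summand of the mass-1 vertex form is non-negative once `D ≥ 0` and all corner coordinates are `≥ 0`
(`(3/2)(a² + b²) + ½ab = (5/4)(a² + b²) + ¼(a + b)² ≥ 0`). Plain real variables; used by the two theorems below. -/
theorem cluster_vertexSum_nonneg (Z₁ Z₂ Z₃ Z₄ Z₅ D p₁ q₁ p₂ q₂ p₃ q₃ p₄ q₄ p₅ q₅ : ℝ)
    (hD : 0 ≤ D)
    (gp₁ : 0 ≤ p₁) (gq₁ : 0 ≤ q₁) (gp₂ : 0 ≤ p₂) (gq₂ : 0 ≤ q₂) (gp₃ : 0 ≤ p₃) (gq₃ : 0 ≤ q₃) (gp₄ : 0 ≤ p₄) (gq₄ : 0 ≤ q₄) (gp₅ : 0 ≤ p₅) (gq₅ : 0 ≤ q₅) :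
    0 ≤ 2 * ((2 * Z₁ ^ 2 + 3/2 * D) * (q₁ * p₁)
        + (1/2 * Z₁ * Z₂ + 3/2 * (Z₁ ^ 2 + Z₂ ^ 2) + 7/4 * D) * (q₁ * p₂ + q₂ * p₁)
        + (1/2 * Z₁ * Z₃ + 3/2 * (Z₁ ^ 2 + Z₃ ^ 2) + 7/4 * D) * (q₁ * p₃ + q₃ * p₁)
        + (1/2 * Z₁ * Z₄ + 3/2 * (Z₁ ^ 2 + Z₄ ^ 2) + 7/4 * D) * (q₁ * p₄ + q₄ * p₁)
        + (1/2 * Z₁ * Z₅ + 3/2 * (Z₁ ^ 2 + Z₅ ^ 2) + 7/4 * D) * (q₁ * p₅ + q₅ * p₁)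
        + (2 * Z₂ ^ 2 + 3/2 * D) * (q₂ * p₂)
        + (1/2 * Z₂ * Z₃ + 3/2 * (Z₂ ^ 2 + Z₃ ^ 2) + 7/4 * D) * (q₂ * p₃ + q₃ * p₂)
        + (1/2 * Z₂ * Z₄ + 3/2 * (Z₂ ^ 2 + Z₄ ^ 2) + 7/4 * D) * (q₂ * p₄ + q₄ * p₂)
        + (1/2 * Z₂ * Z₅ + 3/2 * (Z₂ ^ 2 + Z₅ ^ 2) + 7/4 * D) * (q₂ * p₅ + q₅ * p₂)
        + (2 * Z₃ ^ 2 + 3/2 * D) * (q₃ * p₃)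
        + (1/2 * Z₃ * Z₄ + 3/2 * (Z₃ ^ 2 + Z₄ ^ 2) + 7/4 * D) * (q₃ * p₄ + q₄ * p₃)
        + (1/2 * Z₃ * Z₅ + 3/2 * (Z₃ ^ 2 + Z₅ ^ 2) + 7/4 * D) * (q₃ * p₅ + q₅ * p₃)
        + (5 * Z₄ ^ 2 + 2 * D) * (q₄ * p₄)
        + (1/2 * Z₄ * Z₅ + 3/2 * (Z₄ ^ 2 + Z₅ ^ 2) + 7/4 * D) * (q₄ * p₅ + q₅ * p₄)
        + (5 * Z₅ ^ 2 + 2 * D) * (q₅ * p₅)) := by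
  have t11 : 0 ≤ (2 * Z₁ ^ 2 + 3/2 * D) * (q₁ * p₁) :=
    mul_nonneg (by linarith [sq_nonneg Z₁, hD]) (mul_nonneg gq₁ gp₁)
  have t12 : 0 ≤ (1/2 * Z₁ * Z₂ + 3/2 * (Z₁ ^ 2 + Z₂ ^ 2) + 7/4 * D) * (q₁ * p₂ + q₂ * p₁) :=
    mul_nonneg (by linarith [sq_nonneg (Z₁ + Z₂), sq_nonneg Z₁, sq_nonneg Z₂, hD])
      (add_nonneg (mul_nonneg gq₁ gp₂) (mul_nonneg gq₂ gp₁))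
  have t13 : 0 ≤ (1/2 * Z₁ * Z₃ + 3/2 * (Z₁ ^ 2 + Z₃ ^ 2) + 7/4 * D) * (q₁ * p₃ + q₃ * p₁) :=
    mul_nonneg (by linarith [sq_nonneg (Z₁ + Z₃), sq_nonneg Z₁, sq_nonneg Z₃, hD])
      (add_nonneg (mul_nonneg gq₁ gp₃) (mul_nonneg gq₃ gp₁))
  have t14 : 0 ≤ (1/2 * Z₁ * Z₄ + 3/2 * (Z₁ ^ 2 + Z₄ ^ 2) + 7/4 * D) * (q₁ * p₄ + q₄ * p₁) :=
    mul_nonneg (by linarith [sq_nonneg (Z₁ + Z₄), sq_nonneg Z₁, sq_nonneg Z₄, hD])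
      (add_nonneg (mul_nonneg gq₁ gp₄) (mul_nonneg gq₄ gp₁))
  have t15 : 0 ≤ (1/2 * Z₁ * Z₅ + 3/2 * (Z₁ ^ 2 + Z₅ ^ 2) + 7/4 * D) * (q₁ * p₅ + q₅ * p₁) :=
    mul_nonneg (by linarith [sq_nonneg (Z₁ + Z₅), sq_nonneg Z₁, sq_nonneg Z₅, hD])
      (add_nonneg (mul_nonneg gq₁ gp₅) (mul_nonneg gq₅ gp₁))
  have t22 : 0 ≤ (2 * Z₂ ^ 2 + 3/2 * D) * (q₂ * p₂) :=
    mul_nonneg (by linarith [sq_nonneg Z₂, hD]) (mul_nonneg gq₂ gp₂)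
  have t23 : 0 ≤ (1/2 * Z₂ * Z₃ + 3/2 * (Z₂ ^ 2 + Z₃ ^ 2) + 7/4 * D) * (q₂ * p₃ + q₃ * p₂) :=
    mul_nonneg (by linarith [sq_nonneg (Z₂ + Z₃), sq_nonneg Z₂, sq_nonneg Z₃, hD])
      (add_nonneg (mul_nonneg gq₂ gp₃) (mul_nonneg gq₃ gp₂))
  have t24 : 0 ≤ (1/2 * Z₂ * Z₄ + 3/2 * (Z₂ ^ 2 + Z₄ ^ 2) + 7/4 * D) * (q₂ * p₄ + q₄ * p₂) :=
    mul_nonneg (by linarith [sq_nonneg (Z₂ + Z₄), sq_nonneg Z₂, sq_nonneg Z₄, hD])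
      (add_nonneg (mul_nonneg gq₂ gp₄) (mul_nonneg gq₄ gp₂))
  have t25 : 0 ≤ (1/2 * Z₂ * Z₅ + 3/2 * (Z₂ ^ 2 + Z₅ ^ 2) + 7/4 * D) * (q₂ * p₅ + q₅ * p₂) :=
    mul_nonneg (by linarith [sq_nonneg (Z₂ + Z₅), sq_nonneg Z₂, sq_nonneg Z₅, hD])
      (add_nonneg (mul_nonneg gq₂ gp₅) (mul_nonneg gq₅ gp₂))
  have t33 : 0 ≤ (2 * Z₃ ^ 2 + 3/2 * D) * (q₃ * p₃) :=
    mul_nonneg (by linarith [sq_nonneg Z₃, hD]) (mul_nonneg gq₃ gp₃)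
  have t34 : 0 ≤ (1/2 * Z₃ * Z₄ + 3/2 * (Z₃ ^ 2 + Z₄ ^ 2) + 7/4 * D) * (q₃ * p₄ + q₄ * p₃) :=
    mul_nonneg (by linarith [sq_nonneg (Z₃ + Z₄), sq_nonneg Z₃, sq_nonneg Z₄, hD])
      (add_nonneg (mul_nonneg gq₃ gp₄) (mul_nonneg gq₄ gp₃))
  have t35 : 0 ≤ (1/2 * Z₃ * Z₅ + 3/2 * (Z₃ ^ 2 + Z₅ ^ 2) + 7/4 * D) * (q₃ * p₅ + q₅ * p₃) :=
    mul_nonneg (by linarith [sq_nonneg (Z₃ + Z₅), sq_nonneg Z₃, sq_nonneg Z₅, hD])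
      (add_nonneg (mul_nonneg gq₃ gp₅) (mul_nonneg gq₅ gp₃))
  have t44 : 0 ≤ (5 * Z₄ ^ 2 + 2 * D) * (q₄ * p₄) :=
    mul_nonneg (by linarith [sq_nonneg Z₄, hD]) (mul_nonneg gq₄ gp₄)
  have t45 : 0 ≤ (1/2 * Z₄ * Z₅ + 3/2 * (Z₄ ^ 2 + Z₅ ^ 2) + 7/4 * D) * (q₄ * p₅ + q₅ * p₄) :=
    mul_nonneg (by linarith [sq_nonneg (Z₄ + Z₅), sq_nonneg Z₄, sq_nonneg Z₅, hD])
      (add_nonneg (mul_nonneg gq₄ gp₅) (mul_nonneg gq₅ gp₄))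
  have t55 : 0 ≤ (5 * Z₅ ^ 2 + 2 * D) * (q₅ * p₅) :=
    mul_nonneg (by linarith [sq_nonneg Z₅, hD]) (mul_nonneg gq₅ gp₅)
  exact mul_nonneg (by norm_num) (add_nonneg (add_nonneg (add_nonneg (add_nonneg (add_nonneg (add_nonneg (add_nonneg (add_nonneg (add_nonneg (add_nonneg (add_nonneg (add_nonneg (add_nonneg (add_nonneg t11 t12) t13) t14) t15) t22) t23) t24) t25) t33) t34) t35) t44) t45) t55)

/-- **CONJECTURE K, vertex form.** If every E-root of the (3,2) cluster lies in the future light cone of `V = (yV,uV)` and every F-root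
in its past cone (`|u_k − uV| ≤ ε_k(y_k − yV)`; such a `V` exists iff the cluster is dominant and pairwise ample), and `S_ζ ≤ 0`, then
`G₀(C) = Q₂(C) + Q₄(C) ≥ 0`: all corner coordinates `p_k, q_k` and all `H_kl` are `≥ 0`. -/
theorem cluster_G0_nonneg (y₁ y₂ y₃ y₄ y₅ u₁ u₂ u₃ u₄ u₅ yV uV : ℝ)
    (hp₁ : u₁ - uV ≤ y₁ - yV) (hq₁ : uV - u₁ ≤ y₁ - yV)
    (hp₂ : u₂ - uV ≤ y₂ - yV) (hq₂ : uV - u₂ ≤ y₂ - yV)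
    (hp₃ : u₃ - uV ≤ y₃ - yV) (hq₃ : uV - u₃ ≤ y₃ - yV)
    (hp₄ : u₄ - uV ≤ yV - y₄) (hq₄ : uV - u₄ ≤ yV - y₄)
    (hp₅ : u₅ - uV ≤ yV - y₅) (hq₅ : uV - u₅ ≤ yV - y₅) :
    let yb : ℝ := y₁ + y₂ + y₃ - y₄ - y₅
    let ub : ℝ := u₁ + u₂ + u₃ - u₄ - u₅
    let Y₁ : ℝ := y₁ - yb
    let Y₂ : ℝ := y₂ - yb
    let Y₃ : ℝ := y₃ - yb
    let Y₄ : ℝ := y₄ - yb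
    let Y₅ : ℝ := y₅ - yb
    let Z₁ : ℝ := u₁ - ub
    let Z₂ : ℝ := u₂ - ub
    let Z₃ : ℝ := u₃ - ub
    let Z₄ : ℝ := u₄ - ub
    let Z₅ : ℝ := u₅ - ub
    let Sy : ℝ := Y₁ ^ 2 + Y₂ ^ 2 + Y₃ ^ 2 - (Y₄ ^ 2 + Y₅ ^ 2)
    let Sz : ℝ := Z₁ ^ 2 + Z₂ ^ 2 + Z₃ ^ 2 - (Z₄ ^ 2 + Z₅ ^ 2)
    let Syz : ℝ := Y₁ * Z₁ + Y₂ * Z₂ + Y₃ * Z₃ - (Y₄ * Z₄ + Y₅ * Z₅)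
    let Sy2z2 : ℝ := Y₁ ^ 2 * Z₁ ^ 2 + Y₂ ^ 2 * Z₂ ^ 2 + Y₃ ^ 2 * Z₃ ^ 2 - (Y₄ ^ 2 * Z₄ ^ 2 + Y₅ ^ 2 * Z₅ ^ 2)
    let Sz4 : ℝ := Z₁ ^ 4 + Z₂ ^ 4 + Z₃ ^ 4 - (Z₄ ^ 4 + Z₅ ^ 4)
    Sz ≤ 0 → 0 ≤ 1 / 2 * Sy * Sz + Syz ^ 2 - 3 * Sy2z2 + (3 * Sz4 - 3 / 2 * Sz ^ 2) := by
  intro yb ub Y₁ Y₂ Y₃ Y₄ Y₅ Z₁ Z₂ Z₃ Z₄ Z₅ Sy Sz Syz Sy2z2 Sz4 hS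
  have hD : 0 ≤ (-Sz) := by linarith
  have gp₁ : 0 ≤ ((y₁ + u₁) - (yV + uV)) := by linarith
  have gq₁ : 0 ≤ ((y₁ - u₁) - (yV - uV)) := by linarith
  have gp₂ : 0 ≤ ((y₂ + u₂) - (yV + uV)) := by linarith
  have gq₂ : 0 ≤ ((y₂ - u₂) - (yV - uV)) := by linarith
  have gp₃ : 0 ≤ ((y₃ + u₃) - (yV + uV)) := by linarith
  have gq₃ : 0 ≤ ((y₃ - u₃) - (yV - uV)) := by linarith
  have gp₄ : 0 ≤ ((yV + uV) - (y₄ + u₄)) := by linarith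
  have gq₄ : 0 ≤ ((yV - uV) - (y₄ - u₄)) := by linarith
  have gp₅ : 0 ≤ ((yV + uV) - (y₅ + u₅)) := by linarith
  have gq₅ : 0 ≤ ((yV - uV) - (y₅ - u₅)) := by linarith
  have key : 1 / 2 * Sy * Sz + Syz ^ 2 - 3 * Sy2z2 + (3 * Sz4 - 3 / 2 * Sz ^ 2)
      = 2 * ((2 * Z₁ ^ 2 + 3/2 * (-Sz)) * (((y₁ - u₁) - (yV - uV)) * ((y₁ + u₁) - (yV + uV)))
        + (1/2 * Z₁ * Z₂ + 3/2 * (Z₁ ^ 2 + Z₂ ^ 2) + 7/4 * (-Sz)) * (((y₁ - u₁) - (yV - uV)) * ((y₂ + u₂) - (yV + uV)) + ((y₂ - u₂) - (yV - uV)) * ((y₁ + u₁) - (yV + uV)))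
        + (1/2 * Z₁ * Z₃ + 3/2 * (Z₁ ^ 2 + Z₃ ^ 2) + 7/4 * (-Sz)) * (((y₁ - u₁) - (yV - uV)) * ((y₃ + u₃) - (yV + uV)) + ((y₃ - u₃) - (yV - uV)) * ((y₁ + u₁) - (yV + uV)))
        + (1/2 * Z₁ * Z₄ + 3/2 * (Z₁ ^ 2 + Z₄ ^ 2) + 7/4 * (-Sz)) * (((y₁ - u₁) - (yV - uV)) * ((yV + uV) - (y₄ + u₄)) + ((yV - uV) - (y₄ - u₄)) * ((y₁ + u₁) - (yV + uV)))
        + (1/2 * Z₁ * Z₅ + 3/2 * (Z₁ ^ 2 + Z₅ ^ 2) + 7/4 * (-Sz)) * (((y₁ - u₁) - (yV - uV)) * ((yV + uV) - (y₅ + u₅)) + ((yV - uV) - (y₅ - u₅)) * ((y₁ + u₁) - (yV + uV)))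
        + (2 * Z₂ ^ 2 + 3/2 * (-Sz)) * (((y₂ - u₂) - (yV - uV)) * ((y₂ + u₂) - (yV + uV)))
        + (1/2 * Z₂ * Z₃ + 3/2 * (Z₂ ^ 2 + Z₃ ^ 2) + 7/4 * (-Sz)) * (((y₂ - u₂) - (yV - uV)) * ((y₃ + u₃) - (yV + uV)) + ((y₃ - u₃) - (yV - uV)) * ((y₂ + u₂) - (yV + uV)))
        + (1/2 * Z₂ * Z₄ + 3/2 * (Z₂ ^ 2 + Z₄ ^ 2) + 7/4 * (-Sz)) * (((y₂ - u₂) - (yV - uV)) * ((yV + uV) - (y₄ + u₄)) + ((yV - uV) - (y₄ - u₄)) * ((y₂ + u₂) - (yV + uV)))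
        + (1/2 * Z₂ * Z₅ + 3/2 * (Z₂ ^ 2 + Z₅ ^ 2) + 7/4 * (-Sz)) * (((y₂ - u₂) - (yV - uV)) * ((yV + uV) - (y₅ + u₅)) + ((yV - uV) - (y₅ - u₅)) * ((y₂ + u₂) - (yV + uV)))
        + (2 * Z₃ ^ 2 + 3/2 * (-Sz)) * (((y₃ - u₃) - (yV - uV)) * ((y₃ + u₃) - (yV + uV)))
        + (1/2 * Z₃ * Z₄ + 3/2 * (Z₃ ^ 2 + Z₄ ^ 2) + 7/4 * (-Sz)) * (((y₃ - u₃) - (yV - uV)) * ((yV + uV) - (y₄ + u₄)) + ((yV - uV) - (y₄ - u₄)) * ((y₃ + u₃) - (yV + uV)))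
        + (1/2 * Z₃ * Z₅ + 3/2 * (Z₃ ^ 2 + Z₅ ^ 2) + 7/4 * (-Sz)) * (((y₃ - u₃) - (yV - uV)) * ((yV + uV) - (y₅ + u₅)) + ((yV - uV) - (y₅ - u₅)) * ((y₃ + u₃) - (yV + uV)))
        + (5 * Z₄ ^ 2 + 2 * (-Sz)) * (((yV - uV) - (y₄ - u₄)) * ((yV + uV) - (y₄ + u₄)))
        + (1/2 * Z₄ * Z₅ + 3/2 * (Z₄ ^ 2 + Z₅ ^ 2) + 7/4 * (-Sz)) * (((yV - uV) - (y₄ - u₄)) * ((yV + uV) - (y₅ + u₅)) + ((yV - uV) - (y₅ - u₅)) * ((yV + uV) - (y₄ + u₄)))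
        + (5 * Z₅ ^ 2 + 2 * (-Sz)) * (((yV - uV) - (y₅ - u₅)) * ((yV + uV) - (y₅ + u₅)))) := by
    simp only [Sz4, Sy2z2, Syz, Sz, Sy, Z₅, Z₄, Z₃, Z₂, Z₁, Y₅, Y₄, Y₃, Y₂, Y₁, ub, yb]
    ring
  rw [key]
  exact cluster_vertexSum_nonneg Z₁ Z₂ Z₃ Z₄ Z₅ (-Sz)
    ((y₁ + u₁) - (yV + uV)) ((y₁ - u₁) - (yV - uV)) ((y₂ + u₂) - (yV + uV)) ((y₂ - u₂) - (yV - uV)) ((y₃ + u₃) - (yV + uV)) ((y₃ - u₃) - (yV - uV)) ((yV + uV) - (y₄ + u₄)) ((yV - uV) - (y₄ - u₄)) ((yV + uV) - (y₅ + u₅)) ((yV - uV) - (y₅ - u₅))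
    hD gp₁ gq₁ gp₂ gq₂ gp₃ gq₃ gp₄ gq₄ gp₅ gq₅

/-- **CONJECTURE K (note `CROSS-MAX-G11.md` A1.3) — PROVED**, in the frame coordinates of `WeilClassTestClusterLemmas`:
for a centred dominant (3,2) cluster (top F-root at `−T`, the other at `−T−g`, E-roots at `−T+δ_e`, `T = Σδ_e + g`, charges
`α_e | β₁, β₂ = Σα − β₁`) that is PAIRWISE AMPLE (`|α_e − β₁| ≤ δ_e`, `|α_e − β₂| ≤ δ_e + g`) and has `S_ζ = Σα² − β₁² − β₂² ≤ 0`,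
`G₀(C) = Q₂(C) + Q₄(C) = ½S_yS_ζ + S_{yζ}² − 3S_{y²ζ²} + 3S_{ζ⁴} − (3/2)S_ζ² ≥ 0`. Proof: the vertex form at the vertex
`V = (max_F (y+u), max_F (y−u))` (light-cone coordinates), where all ten corner coordinates are non-negative by ampleness;
then `cluster_vertexSum_nonneg`. Equality holds for instance when all five roots lie on one null line through `V`
(A2.1's cluster `δ = 0, g = T, α_e = β₁ = T, β₂ = 2T` is such a configuration). (`0 ≤ δ_e`, `0 ≤ g` follow from the
ampleness hypotheses and are therefore not assumed.) -/
theorem cluster_G0_nonneg_frame (δ₁ δ₂ δ₃ g α₁ α₂ α₃ β₁ : ℝ)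
    (a₁ : α₁ - β₁ ≤ δ₁) (a₁' : β₁ - α₁ ≤ δ₁)
    (a₂ : α₂ - β₁ ≤ δ₂) (a₂' : β₁ - α₂ ≤ δ₂)
    (a₃ : α₃ - β₁ ≤ δ₃) (a₃' : β₁ - α₃ ≤ δ₃)
    (b₁ : α₁ - (α₁ + α₂ + α₃ - β₁) ≤ δ₁ + g) (b₁' : (α₁ + α₂ + α₃ - β₁) - α₁ ≤ δ₁ + g)
    (b₂ : α₂ - (α₁ + α₂ + α₃ - β₁) ≤ δ₂ + g) (b₂' : (α₁ + α₂ + α₃ - β₁) - α₂ ≤ δ₂ + g)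
    (b₃ : α₃ - (α₁ + α₂ + α₃ - β₁) ≤ δ₃ + g) (b₃' : (α₁ + α₂ + α₃ - β₁) - α₃ ≤ δ₃ + g)
    (hS : α₁ ^ 2 + α₂ ^ 2 + α₃ ^ 2 ≤ β₁ ^ 2 + (α₁ + α₂ + α₃ - β₁) ^ 2) :
    let T : ℝ := δ₁ + δ₂ + δ₃ + g
    let β₂ : ℝ := α₁ + α₂ + α₃ - β₁
    let Sy : ℝ := (δ₁ - T) ^ 2 + (δ₂ - T) ^ 2 + (δ₃ - T) ^ 2 - ((-T) ^ 2 + (-T - g) ^ 2)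
    let Sz : ℝ := α₁ ^ 2 + α₂ ^ 2 + α₃ ^ 2 - (β₁ ^ 2 + β₂ ^ 2)
    let Syz : ℝ := (δ₁ - T) * α₁ + (δ₂ - T) * α₂ + (δ₃ - T) * α₃ - ((-T) * β₁ + (-T - g) * β₂)
    let Sy2z2 : ℝ := (δ₁ - T) ^ 2 * α₁ ^ 2 + (δ₂ - T) ^ 2 * α₂ ^ 2 + (δ₃ - T) ^ 2 * α₃ ^ 2
      - ((-T) ^ 2 * β₁ ^ 2 + (-T - g) ^ 2 * β₂ ^ 2)
    let Sz4 : ℝ := α₁ ^ 4 + α₂ ^ 4 + α₃ ^ 4 - (β₁ ^ 4 + β₂ ^ 4)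
    0 ≤ 1 / 2 * Sy * Sz + Syz ^ 2 - 3 * Sy2z2 + (3 * Sz4 - 3 / 2 * Sz ^ 2) := by
  intro T β₂ Sy Sz Syz Sy2z2 Sz4
  have eβ : β₂ = α₁ + α₂ + α₃ - β₁ := rfl
  -- the vertex `V`: in light-cone coordinates `(y + u, y − u)` the componentwise maximum of the two F-roots
  obtain ⟨PV, hP4, hP5, hPle⟩ : ∃ PV : ℝ, -T + β₁ ≤ PV ∧ -T - g + β₂ ≤ PV ∧
      ∀ x : ℝ, -T + β₁ ≤ x → -T - g + β₂ ≤ x → PV ≤ x :=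
    ⟨max (-T + β₁) (-T - g + β₂), le_max_left _ _, le_max_right _ _, fun x hx hx' => max_le hx hx'⟩
  obtain ⟨MV, hM4, hM5, hMle⟩ : ∃ MV : ℝ, -T - β₁ ≤ MV ∧ -T - g - β₂ ≤ MV ∧
      ∀ x : ℝ, -T - β₁ ≤ x → -T - g - β₂ ≤ x → MV ≤ x :=
    ⟨max (-T - β₁) (-T - g - β₂), le_max_left _ _, le_max_right _ _, fun x hx hx' => max_le hx hx'⟩
  have gp₁ : 0 ≤ (δ₁ - T + α₁ - PV) := by
    have := hPle (δ₁ - T + α₁) (by linarith) (by rw [eβ]; linarith)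
    linarith
  have gq₁ : 0 ≤ (δ₁ - T - α₁ - MV) := by
    have := hMle (δ₁ - T - α₁) (by linarith) (by rw [eβ]; linarith)
    linarith
  have gp₂ : 0 ≤ (δ₂ - T + α₂ - PV) := by
    have := hPle (δ₂ - T + α₂) (by linarith) (by rw [eβ]; linarith)
    linarith
  have gq₂ : 0 ≤ (δ₂ - T - α₂ - MV) := by
    have := hMle (δ₂ - T - α₂) (by linarith) (by rw [eβ]; linarith)
    linarith
  have gp₃ : 0 ≤ (δ₃ - T + α₃ - PV) := by
    have := hPle (δ₃ - T + α₃) (by linarith) (by rw [eβ]; linarith)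
    linarith
  have gq₃ : 0 ≤ (δ₃ - T - α₃ - MV) := by
    have := hMle (δ₃ - T - α₃) (by linarith) (by rw [eβ]; linarith)
    linarith
  have gp₄ : 0 ≤ (PV - (-T + β₁)) := by linarith
  have gq₄ : 0 ≤ (MV - (-T - β₁)) := by linarith
  have gp₅ : 0 ≤ (PV - (-T - g + β₂)) := by linarith
  have gq₅ : 0 ≤ (MV - (-T - g - β₂)) := by linarith
  have hD : 0 ≤ (-Sz) := by
    show 0 ≤ -(α₁ ^ 2 + α₂ ^ 2 + α₃ ^ 2 - (β₁ ^ 2 + β₂ ^ 2))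
    rw [eβ]; linarith
  have key : 1 / 2 * Sy * Sz + Syz ^ 2 - 3 * Sy2z2 + (3 * Sz4 - 3 / 2 * Sz ^ 2)
      = 2 * ((2 * α₁ ^ 2 + 3/2 * (-Sz)) * ((δ₁ - T - α₁ - MV) * (δ₁ - T + α₁ - PV))
        + (1/2 * α₁ * α₂ + 3/2 * (α₁ ^ 2 + α₂ ^ 2) + 7/4 * (-Sz)) * ((δ₁ - T - α₁ - MV) * (δ₂ - T + α₂ - PV) + (δ₂ - T - α₂ - MV) * (δ₁ - T + α₁ - PV))
        + (1/2 * α₁ * α₃ + 3/2 * (α₁ ^ 2 + α₃ ^ 2) + 7/4 * (-Sz)) * ((δ₁ - T - α₁ - MV) * (δ₃ - T + α₃ - PV) + (δ₃ - T - α₃ - MV) * (δ₁ - T + α₁ - PV))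
        + (1/2 * α₁ * β₁ + 3/2 * (α₁ ^ 2 + β₁ ^ 2) + 7/4 * (-Sz)) * ((δ₁ - T - α₁ - MV) * (PV - (-T + β₁)) + (MV - (-T - β₁)) * (δ₁ - T + α₁ - PV))
        + (1/2 * α₁ * β₂ + 3/2 * (α₁ ^ 2 + β₂ ^ 2) + 7/4 * (-Sz)) * ((δ₁ - T - α₁ - MV) * (PV - (-T - g + β₂)) + (MV - (-T - g - β₂)) * (δ₁ - T + α₁ - PV))
        + (2 * α₂ ^ 2 + 3/2 * (-Sz)) * ((δ₂ - T - α₂ - MV) * (δ₂ - T + α₂ - PV))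
        + (1/2 * α₂ * α₃ + 3/2 * (α₂ ^ 2 + α₃ ^ 2) + 7/4 * (-Sz)) * ((δ₂ - T - α₂ - MV) * (δ₃ - T + α₃ - PV) + (δ₃ - T - α₃ - MV) * (δ₂ - T + α₂ - PV))
        + (1/2 * α₂ * β₁ + 3/2 * (α₂ ^ 2 + β₁ ^ 2) + 7/4 * (-Sz)) * ((δ₂ - T - α₂ - MV) * (PV - (-T + β₁)) + (MV - (-T - β₁)) * (δ₂ - T + α₂ - PV))
        + (1/2 * α₂ * β₂ + 3/2 * (α₂ ^ 2 + β₂ ^ 2) + 7/4 * (-Sz)) * ((δ₂ - T - α₂ - MV) * (PV - (-T - g + β₂)) + (MV - (-T - g - β₂)) * (δ₂ - T + α₂ - PV))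
        + (2 * α₃ ^ 2 + 3/2 * (-Sz)) * ((δ₃ - T - α₃ - MV) * (δ₃ - T + α₃ - PV))
        + (1/2 * α₃ * β₁ + 3/2 * (α₃ ^ 2 + β₁ ^ 2) + 7/4 * (-Sz)) * ((δ₃ - T - α₃ - MV) * (PV - (-T + β₁)) + (MV - (-T - β₁)) * (δ₃ - T + α₃ - PV))
        + (1/2 * α₃ * β₂ + 3/2 * (α₃ ^ 2 + β₂ ^ 2) + 7/4 * (-Sz)) * ((δ₃ - T - α₃ - MV) * (PV - (-T - g + β₂)) + (MV - (-T - g - β₂)) * (δ₃ - T + α₃ - PV))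
        + (5 * β₁ ^ 2 + 2 * (-Sz)) * ((MV - (-T - β₁)) * (PV - (-T + β₁)))
        + (1/2 * β₁ * β₂ + 3/2 * (β₁ ^ 2 + β₂ ^ 2) + 7/4 * (-Sz)) * ((MV - (-T - β₁)) * (PV - (-T - g + β₂)) + (MV - (-T - g - β₂)) * (PV - (-T + β₁)))
        + (5 * β₂ ^ 2 + 2 * (-Sz)) * ((MV - (-T - g - β₂)) * (PV - (-T - g + β₂)))) := by
    simp only [Sz4, Sy2z2, Syz, Sz, Sy, β₂, T]
    ring
  rw [key]
  exact cluster_vertexSum_nonneg α₁ α₂ α₃ β₁ β₂ (-Sz)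
    (δ₁ - T + α₁ - PV) (δ₁ - T - α₁ - MV) (δ₂ - T + α₂ - PV) (δ₂ - T - α₂ - MV) (δ₃ - T + α₃ - PV) (δ₃ - T - α₃ - MV) (PV - (-T + β₁)) (MV - (-T - β₁)) (PV - (-T - g + β₂)) (MV - (-T - g - β₂))
    hD gp₁ gq₁ gp₂ gq₂ gp₃ gq₃ gp₄ gq₄ gp₅ gq₅

end Summit.HodgeConjecture.HodgeConjecture.WeilClassTestVertexForm
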